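import Literature.NumberTheory.EllipticCurves.HeegnerPointReflectionProofs
import HarnessLib

/-!
# Hu–Shu–Yin 2019, Prop. 2.1 (1): `X₀(3⁵)/S₃ = E₉` — the degree-`6` modular parametrisation of
# `E₉ : y² + y = x³ − 1` is invariant under the normaliser elements `W` and `A` of `Γ₀(3⁵)`

Topic `NumberTheory/EllipticCurves/HuShuYin2019`; namespace
`Literature.NumberTheory.EllipticCurves.HuShuYin2019`.  Two small DEFINITIONS with bodies (the printed
matrices `W`, `A`), one PREDICATE (the `Prop`-valued structure `IsS3Invariant Dt`, two fields), ONE NAMED FACT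
(`phi_s3Invariant_of_deg_eq_six`, print, `def … : Prop`), and proved API.  No instance, no notation, no `sorry`.
Seat `bsd-cm-k-ty1` (sixteenth seating) on the cell planner's SUMMON D816 (2026-08-29): the input «(G3)» of the
(W2-b) reduction of crux `stmt-BirchSwinnertonDyer-19804` (`UpperOffV0HSYPlus`, stub `stub_levelFixingSeven`;
prover memo `W2B-RECIPROCITY-k7t-c2-g32.md` §3 (G3), §1 (1.4)).  Nothing here is specific to Selmer groups;
no summit statement is proved or advanced by this file alone; BSD is claimed for no curve.

## THE PRINT (Hu–Shu–Yin, Trans. AMS 372 (2019) = arXiv:1708.05266; pages of the held text)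

* §2.1 p. 5 L29: «the quotient group `N/ℚ^×Γ₀(3⁵) ≃ S₃ ⋊ ℤ/3ℤ`, where `S₃` … is generated by the
  Atkin–Lehner operator `W = (0 1; −3⁵ 0)` and the matrix `A = (28 1/3; 3⁴ 1)`» ([AL1970], [Ogg80], [KM1988]);
  «`Γ = GL₂(ℚ)⁺ ∩ U = ⟨Γ₀(3⁵), W, A⟩`», `X_Γ` the modular curve of level `Γ`, «a smooth projective curve over
  `ℚ` of genus `1` … We identify `X_Γ` with an elliptic curve over `ℚ` with `[∞]` as its zero element».
* **Prop. 2.1 (1)** p. 5 L59–L61: «The elliptic curve `(X_Γ, [∞])` is isomorphic to `E₉` over `ℚ`.»  Proof,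
  L76: «It is known from [DV17] that `E₉` is the natural quotient of `X₀(3⁵)` by the finite group `S₃`.»
* §4.1 p. 10 L59: «Let `f : X₀(3⁵) → E₉` be a nontrivial modular parametrization which sends the infinity cusp
  `[∞]` to the zero element `O`. Explicitly, we may take `f` to be the quotient map `X₀(3⁵) → X_Γ = E₉` as in
  Proposition 2.1»; p. 11 L23: «`(f,f)_{R′} = (Vol(X_{R′×})/Vol(X_{R×})) deg f = 6 · …`» (**`deg f = 6`**).
* `E₉ : y² = x³ − 2⁴·3` (p. 5 L57) is `ℚ`-isomorphic to the tree's minimal model `⟨0, 0, 1, 0, −1⟩`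
  (`y² + y = x³ − 1`; `(x, y) ↦ (4x, 8y + 4)`; `SylvesterNineMinimalModel.lean`).

## WHAT IS TYPED, AND HOW IT RELATES TO PRINT

The tree speaks of HSY's `f` through the proxy «a `Dt : ModularParametrizationData ⟨0,0,1,0,−1⟩ 243` with
`Dt.deg = 6`» (`φ := Dt.φ : ℍ → E₉(ℂ)`, `τ ↦ uniformize (c · 2πi ∫_{i∞}^τ f_{E₉})`; this is the convention of
`shaAnPair_mul_height_eq_two_zpow_mul_height_named` clause (2) and of the crux-19804 stubs
`stub_printInputsTwo` / `stub_levelFixingSeven`).  The predicate `IsS3Invariant Dt` says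
`Dt.φ (w₂₄₃ • τ) = Dt.φ τ` and `Dt.φ (A • τ) = Dt.φ τ` for all `τ ∈ ℍ`, with `w₂₄₃ = frickeGL 243 = (0 −1; 243 0)`
(the tree's Fricke matrix; HSY's `W = −w₂₄₃` has the same action on `ℍ`, `glCast_hsyW_smul`) and
`A = hsyA = (28 1/3; 81 1)` — i.e. `φ` factors through `ℍ → X₀(3⁵) → X₀(3⁵)/⟨W, A⟩`.  The named fact
`phi_s3Invariant_of_deg_eq_six` asserts this for EVERY degree-`6` datum.  Print → typed form: HSY's `f` IS the
quotient map by `S₃ = ⟨W, A⟩` (Prop. 2.1 (1), [DV17]) of degree `6` (p. 11), so `f ∘ W = f ∘ A = f` on `ℍ`;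
a degree-`6` datum has `φ = ±f` (all data share the newform, the Néron lattice and the uniformisation, so
`φ = u(c · I)` and `f = u(c_f · I)` with `deg φ = 6 · (c/c_f)²`, whence `c = ±c_f`; `c_f ∈ ℤ` is the Manin
constant of `f` [EdixhovenManin1991, §1]) — the same unprinted pinning that clause (2) of the height display
#19 already uses; recorded, not hidden.  NOT typed here: Prop. 2.1 (2) (`Φ(B) = [ω²]`, `Φ(C) = [ω²] + [1/9]`),
the cusps of `X_Γ`, `Aut(X₀(3⁵)) = N/ℚ^×Γ₀(3⁵)`.

## CONTENTS

* §1 `hsyW`, `hsyA : GL (Fin 2) ℚ` (the printed matrices) and the integral representative `hsyA3 = 3A`, with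
  `rfl` unfolding lemmas, `hsyW = −w₂₄₃` (`hsyW_eq_neg_frickeGL`), `glCast hsyW • τ = glCast w₂₄₃ • τ`
  (`glCast_hsyW_smul`), `glCast hsyA3 • τ = glCast hsyA • τ` (`glCast_hsyA3_smul`), and `A³ ∈ Γ₀(3⁵)`:
  `hsyA ^ 3 = slToGLPos γ_A` for the explicit `γ_A = (23491 280; 68040 811) ∈ Γ₀(243)` (`hsyA_pow_three`).
* §2 `IsS3Invariant Dt` (a `Prop`-structure: `frickeGL_smul`, `hsyA_smul`; `isS3Invariant_iff`) and its API: invariance under every element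
  of the subgroup of `GL₂(ℚ)` generated by `w₂₄₃` and `A` (`IsS3Invariant.smul_of_mem_closure`), under HSY's
  literal `W` (`IsS3Invariant.hsyW_smul`) and under the words `W·Aⁱ` (`IsS3Invariant.frickeGL_mul_hsyA_pow_smul`).
* §3 THE NAMED FACT `phi_s3Invariant_of_deg_eq_six` and its pointwise readings.

## References

* [HuShuYin2019] Y. Hu, J. Shu, H. Yin, *An explicit Gross–Zagier formula related to the Sylvester conjecture*,
  Trans. AMS 372 (2019) (arXiv:1708.05266): §2.1, Prop. 2.1 (1) (p. 5), §4.1 (p. 10 L59, p. 11 L23).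
* [DasguptaVoight2018] S. Dasgupta, J. Voight, *Sylvester's problem and mock Heegner points*, Proc. AMS 146
  (2018) (HSY's [DV17]: `E₉ = X₀(243)/S₃`).
* [AtkinLehner1970] A. O. L. Atkin, J. Lehner, *Hecke operators on Γ₀(m)*, Math. Ann. 185 (1970), §2
  (normaliser, `w_N`).
* [EdixhovenManin1991] B. Edixhoven, *On the Manin constants of modular elliptic curves* (1991), §1.
-/

noncomputable section

open UpperHalfPlane
open scoped MatrixGroups

namespace Literature.NumberTheory.EllipticCurves.HuShuYin2019

open Literature.NumberTheory.EllipticCurves.ModularForms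
open Literature.NumberTheory.EllipticCurves.ModularForms.ModularParametrizationData

/-! ## §1. The normaliser elements `W` and `A` of `Γ₀(3⁵)` (Hu–Shu–Yin §2.1) -/

section Matrices

/-- **Hu–Shu–Yin's Atkin–Lehner matrix `W = (0 1; −3⁵ 0) ∈ GL₂(ℚ)⁺`** (determinant `243`); it is `−w₂₄₃`
for the tree's Fricke matrix `w_N = (0 −1; N 0)` (`frickeGL`, `hsyW_eq_neg_frickeGL`) and has the same action on
`ℍ`. [cite: HuShuYin2019, §2.1 (p. 5 L29)] -/
def hsyW : GL (Fin 2) ℚ :=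
  Matrix.GeneralLinearGroup.mkOfDetNeZero !![(0 : ℚ), 1; -243, 0] (by norm_num [Matrix.det_fin_two])

/-- **Hu–Shu–Yin's matrix `A = (28 1/3; 3⁴ 1) ∈ GL₂(ℚ)⁺`** (determinant `1`), the second generator of
`S₃ ≤ N/ℚ^×Γ₀(3⁵) = Aut(X₀(3⁵))`. [cite: HuShuYin2019, §2.1 (p. 5 L29)] -/
def hsyA : GL (Fin 2) ℚ :=
  Matrix.GeneralLinearGroup.mkOfDetNeZero !![(28 : ℚ), 1 / 3; 81, 1] (by norm_num [Matrix.det_fin_two])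

/-- The matrix of `hsyW`. [cite: HuShuYin2019, §2.1 (p. 5 L29)] -/
@[simp] theorem coe_hsyW : ((hsyW : GL (Fin 2) ℚ) : Matrix (Fin 2) (Fin 2) ℚ) = !![(0 : ℚ), 1; -243, 0] :=
  rfl

/-- The matrix of `hsyA`. [cite: HuShuYin2019, §2.1 (p. 5 L29)] -/
@[simp] theorem coe_hsyA : ((hsyA : GL (Fin 2) ℚ) : Matrix (Fin 2) (Fin 2) ℚ) = !![(28 : ℚ), 1 / 3; 81, 1] :=
  rfl

/-- `det W = 243`. [cite: HuShuYin2019, §2.1] -/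
theorem det_hsyW : (hsyW : GL (Fin 2) ℚ).det.val = 243 := by
  simp [Matrix.GeneralLinearGroup.val_det_apply, Matrix.det_fin_two]

/-- `det A = 1`. [cite: HuShuYin2019, §2.1] -/
theorem det_hsyA : (hsyA : GL (Fin 2) ℚ).det.val = 1 := by
  simp [Matrix.GeneralLinearGroup.val_det_apply, Matrix.det_fin_two]
  norm_num

/-- **`W = −w₂₄₃`** for the tree's Fricke matrix `w₂₄₃ = (0 −1; 243 0)` (`frickeGL 243`).
[cite: AtkinLehner1970, §2] -/
theorem hsyW_eq_neg_frickeGL : hsyW = -(frickeGL 243 : GL (Fin 2) ℚ) := by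
  ext i j
  fin_cases i <;> fin_cases j <;> simp [hsyW, coe_coe_frickeGL]

/-- `glCast` commutes with negation. [folklore] -/
private theorem glCast_neg (g : GL (Fin 2) ℚ) : glCast (-g) = -glCast g := by
  ext i j
  simp [glCast]

/-- **HSY's `W` acts on `ℍ` as the Fricke involution `w₂₄₃`** (`−g` and `g` have the same Möbius action,
Mathlib `UpperHalfPlane.neg_smul`). [cite: HuShuYin2019, §2.1 (p. 5 L29)] -/
theorem glCast_hsyW_smul (τ : ℍ) : glCast hsyW • τ = glCast (frickeGL 243 : GL (Fin 2) ℚ) • τ := by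
  rw [hsyW_eq_neg_frickeGL, glCast_neg, UpperHalfPlane.neg_smul]

/-- The INTEGRAL representative `3A = (84 1; 243 3) ∈ GL₂(ℚ)⁺` (determinant `9`) of `A` modulo scalars (the matrix
`atkinA` of the crux-19804 sketch `S3FibreTransportSketch`); same action on `ℍ` (`glCast_hsyA3_smul`).
[cite: HuShuYin2019, §2.1 (p. 5 L29)] -/
def hsyA3 : GL (Fin 2) ℚ :=
  Matrix.GeneralLinearGroup.mkOfDetNeZero !![(84 : ℚ), 1; 243, 3] (by norm_num [Matrix.det_fin_two])

/-- The matrix of `hsyA3`. [cite: HuShuYin2019, §2.1 (p. 5 L29)] -/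
@[simp] theorem coe_hsyA3 : ((hsyA3 : GL (Fin 2) ℚ) : Matrix (Fin 2) (Fin 2) ℚ) = !![(84 : ℚ), 1; 243, 3] :=
  rfl

/-- `3A = (scalar 3) · A` in `GL₂(ℚ)`. [cite: HuShuYin2019, §2.1 (p. 5 L29)] -/
theorem hsyA3_eq_scalar_mul_hsyA :
    hsyA3 = Matrix.GeneralLinearGroup.scalar (Fin 2) (Units.mk0 (3 : ℚ) (by norm_num)) * hsyA := by
  ext i j
  fin_cases i <;> fin_cases j <;> simp [hsyA3, hsyA, Matrix.mul_apply, Fin.sum_univ_two] <;> norm_num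

/-- `glCast` of a scalar matrix is the scalar matrix. [folklore] -/
private theorem glCast_scalar (u : ℚˣ) :
    glCast (Matrix.GeneralLinearGroup.scalar (Fin 2) u) =
      Matrix.GeneralLinearGroup.scalar (Fin 2) (Units.map (Rat.castHom ℝ : ℚ →* ℝ) u) := by
  ext i j
  fin_cases i <;> fin_cases j <;> simp [glCast]

/-- **`3A` acts on `ℍ` as `A`** (scalars act trivially, Mathlib `UpperHalfPlane.glScalar_smul`).
[cite: HuShuYin2019, §2.1 (p. 5 L29)] -/
theorem glCast_hsyA3_smul (τ : ℍ) : glCast hsyA3 • τ = glCast hsyA • τ := by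
  rw [hsyA3_eq_scalar_mul_hsyA, show glCast (Matrix.GeneralLinearGroup.scalar (Fin 2) (Units.mk0 (3 : ℚ)
      (by norm_num)) * hsyA) = glCast (Matrix.GeneralLinearGroup.scalar (Fin 2) (Units.mk0 (3 : ℚ) (by norm_num)))
      * glCast hsyA from map_mul _ _ _, mul_smul, glCast_scalar, UpperHalfPlane.glScalar_smul]

/-- The element `γ_A = (23491 280; 68040 811)` of `SL(2, ℤ)` (`det = 1`; `243 ∣ 68040 = 243 · 280`), which is
`A³`. [cite: HuShuYin2019, §2.1 (p. 5 L29: `A` has order `3` in `N/ℚ^×Γ₀(3⁵)`)] -/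
def hsyGammaA : SL(2, ℤ) :=
  ⟨!![23491, 280; 68040, 811], by norm_num [Matrix.det_fin_two]⟩

/-- `γ_A ∈ Γ₀(243)`. [cite: HuShuYin2019, §2.1 (p. 5 L29)] -/
theorem hsyGammaA_mem_gamma0 : hsyGammaA ∈ CongruenceSubgroup.Gamma0 243 := by
  rw [CongruenceSubgroup.Gamma0_mem]
  decide

/-- **`A³ = γ_A ∈ Γ₀(3⁵)`** (so `A` has order `3` in `Aut(X₀(3⁵)) = N/ℚ^×Γ₀(3⁵)`), as an identity in `GL₂(ℚ)`
with the tree's `slToGLPos : SL(2, ℤ) →* GL(2, ℚ)⁺`. [cite: HuShuYin2019, §2.1 (p. 5 L29)] -/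
theorem hsyA_pow_three : hsyA ^ 3 = (slToGLPos hsyGammaA : GL (Fin 2) ℚ) := by
  ext i j
  fin_cases i <;> fin_cases j <;>
    simp [hsyA, hsyGammaA, slToGLPos, pow_succ, Matrix.mul_apply, Fin.sum_univ_two] <;> norm_num

/-- `W² = −243` is scalar, so `W` is an involution of `X₀(3⁵)`. [cite: AtkinLehner1970, Lemma 7] -/
theorem hsyW_mul_hsyW : hsyW * hsyW = -(Matrix.GeneralLinearGroup.scalar (Fin 2) (Units.mk0 (243 : ℚ)
    (by norm_num))) := by
  ext i j
  fin_cases i <;> fin_cases j <;> simp [hsyW, Matrix.mul_apply, Fin.sum_univ_two]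

end Matrices

/-! ## §2. The predicate: `Dt.φ` is invariant under `⟨W, A⟩` -/

section Predicate

variable (Dt : ModularParametrizationData (⟨0, 0, 1, 0, -1⟩ : WeierstrassCurve ℚ) 243)

/-- **`IsS3Invariant Dt`: the modular parametrisation `Dt.φ : ℍ → E₉(ℂ)` of `E₉ : y² + y = x³ − 1` at level
`3⁵` is invariant under the two generators `W` (Fricke, through the tree's `w₂₄₃ = frickeGL 243`, same action as
HSY's `W`) and `A = (28 1/3; 81 1)` of `S₃ ≤ Aut(X₀(3⁵))`** — i.e. `Dt.φ` factors through the quotient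
`X₀(3⁵) → X₀(3⁵)/⟨W, A⟩ = X_Γ`.  For HSY's `f` (the quotient map `X₀(3⁵) → X_Γ = E₉`, Prop. 2.1 (1) / [DV17])
this holds by construction; the named fact `phi_s3Invariant_of_deg_eq_six` asserts it for every degree-`6` datum
(the tree's proxy for `f`).  A predicate with a body — no truth value is claimed by this definition.
[cite: HuShuYin2019, Prop. 2.1 (1) (p. 5 L59–L61, L76) and §4.1 (p. 10 L59)] -/
structure IsS3Invariant : Prop where
  /-- `W`-invariance, through the tree's Fricke matrix `w₂₄₃ = frickeGL 243` (same action as HSY's `W`). -/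
  frickeGL_smul : ∀ τ : ℍ, Dt.φ (glCast (frickeGL 243 : GL (Fin 2) ℚ) • τ) = Dt.φ τ
  /-- `A`-invariance, `A = hsyA = (28 1/3; 81 1)`. -/
  hsyA_smul : ∀ τ : ℍ, Dt.φ (glCast hsyA • τ) = Dt.φ τ

/-- Unfolding `IsS3Invariant` as the conjunction over `τ ∈ ℍ` (the shape of an explicit binder
`(hS3 : ∀ τ, Dt.φ (w₂₄₃ • τ) = Dt.φ τ ∧ Dt.φ (A • τ) = Dt.φ τ)`). [cite: HuShuYin2019, Prop. 2.1 (1)] -/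
theorem isS3Invariant_iff : IsS3Invariant Dt ↔
    ∀ τ : ℍ, Dt.φ (glCast (frickeGL 243 : GL (Fin 2) ℚ) • τ) = Dt.φ τ ∧ Dt.φ (glCast hsyA • τ) = Dt.φ τ :=
  ⟨fun h τ ↦ ⟨h.frickeGL_smul τ, h.hsyA_smul τ⟩, fun h ↦ ⟨fun τ ↦ (h τ).1, fun τ ↦ (h τ).2⟩⟩

variable {Dt}

namespace IsS3Invariant

/-- Constructor from the conjunction form. [cite: HuShuYin2019, Prop. 2.1 (1)] -/
theorem of_forall
    (h : ∀ τ : ℍ, Dt.φ (glCast (frickeGL 243 : GL (Fin 2) ℚ) • τ) = Dt.φ τ ∧ Dt.φ (glCast hsyA • τ) = Dt.φ τ) :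
    IsS3Invariant Dt :=
  (isS3Invariant_iff Dt).2 h

/-- Constructor from HSY's literal generators `W = (0 1; −243 0)` and `A`. [cite: HuShuYin2019, Prop. 2.1 (1)] -/
theorem of_hsyW_hsyA (hW : ∀ τ : ℍ, Dt.φ (glCast hsyW • τ) = Dt.φ τ)
    (hA : ∀ τ : ℍ, Dt.φ (glCast hsyA • τ) = Dt.φ τ) : IsS3Invariant Dt :=
  ⟨fun τ ↦ by rw [← glCast_hsyW_smul]; exact hW τ, hA⟩

/-- `W`-invariance for HSY's literal `W = (0 1; −243 0)`. [cite: HuShuYin2019, Prop. 2.1 (1)] -/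
theorem hsyW_smul (h : IsS3Invariant Dt) (τ : ℍ) : Dt.φ (glCast hsyW • τ) = Dt.φ τ := by
  rw [glCast_hsyW_smul, h.frickeGL_smul]

/-- `3A`-invariance (integral representative). [cite: HuShuYin2019, Prop. 2.1 (1)] -/
theorem hsyA3_smul (h : IsS3Invariant Dt) (τ : ℍ) : Dt.φ (glCast hsyA3 • τ) = Dt.φ τ := by
  rw [glCast_hsyA3_smul, h.hsyA_smul]

/-- **Invariance under the whole group `⟨w₂₄₃, A⟩ ≤ GL₂(ℚ)`** (every word in `W^{±1}`, `A^{±1}`; in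
`Aut(X₀(3⁵))` this is `S₃`). [cite: HuShuYin2019, Prop. 2.1 (1) (p. 5 L76: «`E₉` is the natural quotient of
`X₀(3⁵)` by the finite group `S₃`»)] -/
theorem smul_of_mem_closure (h : IsS3Invariant Dt) {g : GL (Fin 2) ℚ}
    (hg : g ∈ Subgroup.closure ({(frickeGL 243 : GL (Fin 2) ℚ), hsyA} : Set (GL (Fin 2) ℚ))) (τ : ℍ) :
    Dt.φ (glCast g • τ) = Dt.φ τ := by
  induction hg using Subgroup.closure_induction generalizing τ with
  | mem x hx =>
    rcases hx with rfl | rfl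
    · exact h.frickeGL_smul τ
    · exact h.hsyA_smul τ
  | one => simp
  | mul x y _ _ hx hy => rw [show glCast (x * y) = glCast x * glCast y from map_mul _ x y, mul_smul, hx, hy]
  | inv x _ hx =>
    have h' := hx ((glCast x)⁻¹ • τ)
    rw [smul_inv_smul] at h'
    rw [show glCast x⁻¹ = (glCast x)⁻¹ from map_inv _ x]
    exact h'.symm

/-- HSY's literal `W` lies in `⟨w₂₄₃, A⟩` (it is `−w₂₄₃ = w₂₄₃ · (−1)` and `−1 = w₂₄₃² / 243`… — we only need
the action, so we record membership of `−w₂₄₃` via `w₂₄₃⁻¹ · (w₂₄₃ · w₂₄₃) = …`); stated as the action identity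
`Dt.φ (glCast (hsyW * g) • τ) = Dt.φ (glCast g • τ)`. [cite: HuShuYin2019, Prop. 2.1 (1)] -/
theorem hsyW_mul_smul (h : IsS3Invariant Dt) (g : GL (Fin 2) ℚ) (τ : ℍ) :
    Dt.φ (glCast (hsyW * g) • τ) = Dt.φ (glCast g • τ) := by
  rw [show glCast (hsyW * g) = glCast hsyW * glCast g from map_mul _ _ _, mul_smul, h.hsyW_smul]

/-- **Invariance under the reflections `W · Aⁱ`** (`i = 0, 1, 2`: the three involutions of `S₃`; the
element `W A^{i(p mod 27, n mod 3)}` of the (W2-b) memo §1 (1.3)). [cite: HuShuYin2019, Prop. 2.1 (1)] -/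
theorem hsyW_mul_hsyA_pow_smul (h : IsS3Invariant Dt) (i : ℕ) (τ : ℍ) :
    Dt.φ (glCast (hsyW * hsyA ^ i) • τ) = Dt.φ τ := by
  rw [h.hsyW_mul_smul]
  refine h.smul_of_mem_closure (Subgroup.pow_mem _ (Subgroup.subset_closure ?_) i) τ
  simp

/-- The same with the tree's Fricke matrix: `Dt.φ ((w₂₄₃ Aⁱ) • τ) = Dt.φ τ`. [cite: HuShuYin2019, Prop. 2.1 (1)] -/
theorem frickeGL_mul_hsyA_pow_smul (h : IsS3Invariant Dt) (i : ℕ) (τ : ℍ) :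
    Dt.φ (glCast ((frickeGL 243 : GL (Fin 2) ℚ) * hsyA ^ i) • τ) = Dt.φ τ := by
  refine h.smul_of_mem_closure (Subgroup.mul_mem _ (Subgroup.subset_closure (by simp))
    (Subgroup.pow_mem _ (Subgroup.subset_closure (by simp)) i)) τ

/-- `Aⁱ W`-invariance (the other orientation of the words). [cite: HuShuYin2019, Prop. 2.1 (1)] -/
theorem hsyA_pow_mul_frickeGL_smul (h : IsS3Invariant Dt) (i : ℕ) (τ : ℍ) :
    Dt.φ (glCast (hsyA ^ i * (frickeGL 243 : GL (Fin 2) ℚ)) • τ) = Dt.φ τ := by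
  refine h.smul_of_mem_closure (Subgroup.mul_mem _
    (Subgroup.pow_mem _ (Subgroup.subset_closure (by simp)) i) (Subgroup.subset_closure (by simp))) τ

end IsS3Invariant

/-- With Fricke eigenvalue `+1` (the case of `E₉`, root number `−1`), `W`-invariance of `Dt.φ` is equivalent to
the vanishing of the image `Dt.φ(0) = Dt.cuspZeroPoint` of the cusp `0` (`φ(w_N τ) = ε φ(τ) + φ(0)`,
`φ_frickeGL_smul`). [cite: CremonaAlgorithms1997, §2.10 (2.10.6)] -/
theorem frickeGL_smul_eq_iff_cuspZeroPoint_eq_zero (hW : IsFrickeEigen 243 Dt.f ((1 : ℤ) : ℂ)) :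
    (∀ τ : ℍ, Dt.φ (glCast (frickeGL 243 : GL (Fin 2) ℚ) • τ) = Dt.φ τ) ↔ Dt.cuspZeroPoint = 0 := by
  constructor
  · intro h
    have h1 := φ_frickeGL_smul Dt hW UpperHalfPlane.I
    rw [h, one_zsmul] at h1
    exact (add_eq_left.mp h1.symm)
  · intro h0 τ
    rw [φ_frickeGL_smul Dt hW τ, h0, add_zero, one_zsmul]

end Predicate

/-! ## §3. The named fact: Hu–Shu–Yin Prop. 2.1 (1) for the degree-`6` datum -/

section Fact

/-- **Hu–Shu–Yin 2019, Prop. 2.1 (1) with §4.1: the degree-`6` modular parametrisation of `E₉` is the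
`S₃`-quotient map, hence `⟨W, A⟩`-invariant.**  PRINT: «The elliptic curve `(X_Γ, [∞])` is isomorphic to `E₉`
over `ℚ`» for `Γ = ⟨Γ₀(3⁵), W, A⟩` (Prop. 2.1 (1), p. 5; proof: «It is known from [DV17] that `E₉` is the
natural quotient of `X₀(3⁵)` by the finite group `S₃`», `S₃ = ⟨W, A⟩`, `W = (0 1; −3⁵ 0)`, `A = (28 1/3; 3⁴ 1)`,
p. 5 L29); «we may take `f` to be the quotient map `X₀(3⁵) → X_Γ = E₉`» sending `[∞] ↦ O` (p. 10 L59);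
«`deg f = 6`» (p. 11 L23).  TYPED over the tree's proxy for `f` — every
`Dt : ModularParametrizationData ⟨0,0,1,0,−1⟩ 243` with `Dt.deg = 6` (the convention of
`shaAnPair_mul_height_eq_two_zpow_mul_height_named` (2) and of crux 19804; such a datum is `±f`, module
docstring) —: `Dt.φ (w₂₄₃ • τ) = Dt.φ τ` and `Dt.φ (A • τ) = Dt.φ τ` for all `τ ∈ ℍ` (`IsS3Invariant Dt`; `w₂₄₃` =
the tree's `frickeGL 243`, same action as HSY's `W`, `glCast_hsyW_smul`).  STATUS: PUB (Trans. AMS), relying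
on [DV17] (Proc. AMS); a FACT, not our theorem.
[cite: HuShuYin2019, Prop. 2.1 (1) (p. 5 L59–L61, proof L76), §2.1 (p. 5 L29), §4.1 (p. 10 L59, p. 11 L23)]
[cite: DasguptaVoight2018, §2 (E₉ = X₀(243)/S₃)] -/
def phi_s3Invariant_of_deg_eq_six : Prop :=
  ∀ Dt : ModularParametrizationData (⟨0, 0, 1, 0, -1⟩ : WeierstrassCurve ℚ) 243, Dt.deg = 6 → IsS3Invariant Dt

/-- Pointwise reading of the fact: `W`- and `A`-invariance of `Dt.φ` for a degree-`6` datum (the shape of the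
`hS3` binder of the (W2-b) reduction files). [cite: HuShuYin2019, Prop. 2.1 (1)] -/
theorem phi_s3Invariant_of_deg_eq_six.smul_eq (h : phi_s3Invariant_of_deg_eq_six)
    (Dt : ModularParametrizationData (⟨0, 0, 1, 0, -1⟩ : WeierstrassCurve ℚ) 243) (hdeg : Dt.deg = 6) (τ : ℍ) :
    Dt.φ (glCast (frickeGL 243 : GL (Fin 2) ℚ) • τ) = Dt.φ τ ∧ Dt.φ (glCast hsyA • τ) = Dt.φ τ :=
  (isS3Invariant_iff Dt).1 (h Dt hdeg) τ

/-- Reading on the closure: a degree-`6` datum is invariant under every element of `⟨w₂₄₃, A⟩ ≤ GL₂(ℚ)`.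
[cite: HuShuYin2019, Prop. 2.1 (1)] -/
theorem phi_s3Invariant_of_deg_eq_six.smul_of_mem_closure (h : phi_s3Invariant_of_deg_eq_six)
    (Dt : ModularParametrizationData (⟨0, 0, 1, 0, -1⟩ : WeierstrassCurve ℚ) 243) (hdeg : Dt.deg = 6)
    {g : GL (Fin 2) ℚ} (hg : g ∈ Subgroup.closure ({(frickeGL 243 : GL (Fin 2) ℚ), hsyA} : Set (GL (Fin 2) ℚ)))
    (τ : ℍ) : Dt.φ (glCast g • τ) = Dt.φ τ :=
  (h Dt hdeg).smul_of_mem_closure hg τ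

/-- The existential reading matching `stub_printInputsTwo`'s first conjunct: given SOME degree-`6` datum (HSY's
`f` exists), there is a degree-`6` datum with `⟨W, A⟩`-invariant `φ`. [cite: HuShuYin2019, Prop. 2.1 (1), §4.1] -/
theorem phi_s3Invariant_of_deg_eq_six.exists_of_exists (h : phi_s3Invariant_of_deg_eq_six)
    (hex : ∃ Dt : ModularParametrizationData (⟨0, 0, 1, 0, -1⟩ : WeierstrassCurve ℚ) 243, Dt.deg = 6) :
    ∃ Dt : ModularParametrizationData (⟨0, 0, 1, 0, -1⟩ : WeierstrassCurve ℚ) 243,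
      Dt.deg = 6 ∧ IsS3Invariant Dt := by
  obtain ⟨Dt, hdeg⟩ := hex
  exact ⟨Dt, hdeg, h Dt hdeg⟩

end Fact

end Literature.NumberTheory.EllipticCurves.HuShuYin2019

end
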